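import Mathlib
import HarnessLib
import Summits.HubbardSuperconductivity.HubbardSuperconductivity.Theorems.KLProgrammeKLRegimeCountertermV11Volume
import Summits.HubbardSuperconductivity.HubbardSuperconductivity.Theorems.KLProgrammeKLRegimeSplitTwoLegMultiSlot
import Summits.HubbardSuperconductivity.HubbardSuperconductivity.Theorems.KLProgrammeH10TwoPointLimitFramePerturbation

/-!
# Route `KLProgramme` — the COUNTERTERM child of gen 3 (`KLRegimeCountertermV11`, stmt-HubbardSuperconductivity-19825):
# the THRESHOLD ARITHMETIC of the wholesale continuation — the five side conditions of `frameOK_of_multiSlot` at child 2's package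
# `ctRenMs G`, discharged once in the regime `klBetaMin ≤ β ≤ e^{c/U²}` (seat p2 g5, cell gate-hubbard-kl)

The self-map half of the gen-3 counterterm child (`frameOK_of_multiSlot`, hubbard-kl-k3c3-p2, `…CountertermMultiSlotSelfMap`) turns the
multi-slot sizes (E3a-MS) of the two-leg pieces into `FrameOK R U (nScales β) μ` of every Picard iterate `P^G(K) ⊖ D_n^G(K)`, PROVIDED five
pieces of arithmetic hold: (ha) `2(S_j + S′_j|U|) ≤ R.Gfr j` (`j ≤ 4`), (hb) `Σ_{i ≤ n} msBar G Q U i ≤ 1/2`, and the three order-`≤ 2`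
allowance sums over the slots `m ≤ nScales β` — (h0) `≤ 3/80`, (h1) `≤ 1/2000`, (h2) `≤ 1/100` (the `GeomConstants` half of `FrameOK`,
`geomConstants_of_pieces`).  This module discharges them ONCE, in the exact syntactic shape `frameOK_of_multiSlot` consumes, for child 2's
package of record `ctRenMs G = ⟨5S₀+1, 1, j ↦ 2(S_j+1)⟩`:

* §1 the allowance sums in closed form for ANY `R` with `Gfr ≥ 0`: orders `0, 1` are geometric (`≤ 2·Gfr 0·|U|`, `≤ 2·Gfr 1·U²`), order `2`
  is `Gfr 2·U²·(nScales β + 1)` — linear in the number of scales, hence small only through the regime: `U²·(nScales β + 1) ≤ c/log 4`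
  (`PerturbedFermiCurve.sq_mul_nScales_succ_le`); this is where `CountertermP2`'s `∃ c₁ ∀ c ≤ c₁` is spent;
* §2 `allowanceSums_thresholds`: for any `R`, explicit `c₂(R), U₂(R) > 0` beyond which (h0), (h1), (h2) hold at every `β` of the regime;
* §3 the package: `ctRenMs_room` ((ha) once `Q.S′ j·|U| ≤ 1`), `sum_msBar_le_half` ((hb) once `klMsKappa·(S 1 + S′ 1)·U·(4/3) ≤ 1/2`, `U ≤ 1`),
  and the one-stop `ctRenMs_thresholds`: `∃ c₂ > 0, ∃ U₂ > 0` such that for `0 ≤ c ≤ c₂`, `0 < U ≤ U₂`, `klBetaMin ≤ β ≤ e^{c/U²}` ALL FIVE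
  hold (the (hb) clause for every `n`);
* §4 `exists_volume_threshold`: the construction volume `L₀` — beyond any given `Lmin`, with `a n / L₀ ≤ t n` for finitely many nonnegative
  `a n` against positive tolerances `t n` (the `Q.CL β n / L₀ ≤ ½·tol_n` clause of `CtOneVolumeMsV11`, `n ≤ nScales β`).

Proofs only (real arithmetic); nothing is asserted about the model.  References: `…CountertermMultiSlotSelfMap` (the consumer),
`…CountertermV11Volume` §2 (`ctRenMs`), `…SplitTwoLegMultiSlot` (`msBar`, `sum_msBar_le`), `…H10TwoPointLimitFramePerturbation`
(`frame_thresholds`, the pattern; `sum_four_zpow_le_two`; `sq_mul_nScales_succ_le`).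
-/

noncomputable section

namespace Summit.HubbardSuperconductivity.HubbardSuperconductivity.Theorems.KLRegimeSplit

set_option linter.dupNamespace false -- summit = problem name (single-conjunct summit), D-0017

open Real Finset
open Summit.HubbardSuperconductivity.HubbardSuperconductivity.Theorems.PerturbedFermiCurve

/-! ## §1 The three allowance sums in closed form (any package `R`) -/

/-- The slot-`m` exponent at order `0`: `4^{(0-2)m} = (16^m)⁻¹`. -/
theorem four_zpow_order_zero (m : ℕ) : (4 : ℝ) ^ (((0 : ℤ) - 2) * (m : ℤ)) = ((16 : ℝ) ^ m)⁻¹ := by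
  rw [show ((0 : ℤ) - 2) * (m : ℤ) = -((2 * m : ℕ) : ℤ) by push_cast; ring, zpow_neg, zpow_natCast, pow_mul]
  norm_num

/-- The slot-`m` exponent at order `1`: `4^{(1-2)m} = (4^m)⁻¹`. -/
theorem four_zpow_order_one (m : ℕ) : (4 : ℝ) ^ (((1 : ℤ) - 2) * (m : ℤ)) = ((4 : ℝ) ^ m)⁻¹ := by
  rw [show ((1 : ℤ) - 2) * (m : ℤ) = -((m : ℕ) : ℤ) by push_cast; ring, zpow_neg, zpow_natCast]

/-- The slot-`m` exponent at order `2`: `4^{(2-2)m} = 1`. -/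
theorem four_zpow_order_two (m : ℕ) : (4 : ℝ) ^ (((2 : ℤ) - 2) * (m : ℤ)) = 1 := by
  rw [show ((2 : ℤ) - 2) * (m : ℤ) = 0 by ring, zpow_zero]

/-- `Σ_{m ≤ N} (16^m)⁻¹ ≤ 16/15 ≤ 2`. [folklore] -/
theorem sum_inv_sixteen_pow_le (N : ℕ) : ∑ m ∈ range (N + 1), ((16 : ℝ) ^ m)⁻¹ ≤ 16 / 15 := by
  have h : ∑ m ∈ range (N + 1), ((16 : ℝ) ^ m)⁻¹ = ∑ m ∈ range (N + 1), ((1 : ℝ) / 16) ^ m := by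
    refine sum_congr rfl fun m _ => ?_
    rw [one_div, inv_pow]
  rw [h]
  exact (sum_pow_le_inv_one_sub (by norm_num) (by norm_num) _).trans (by norm_num)

/-- `Σ_{m ≤ N} (4^m)⁻¹ ≤ 4/3`. [folklore] -/
theorem sum_inv_four_pow_le (N : ℕ) : ∑ m ∈ range (N + 1), ((4 : ℝ) ^ m)⁻¹ ≤ 4 / 3 := by
  have h : ∑ m ∈ range (N + 1), ((4 : ℝ) ^ m)⁻¹ = ∑ m ∈ range (N + 1), ((1 : ℝ) / 4) ^ m := by
    refine sum_congr rfl fun m _ => ?_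
    rw [one_div, inv_pow]
  rw [h]
  exact (sum_pow_le_inv_one_sub (by norm_num) (by norm_num) _).trans (by norm_num)

/-- **(h0) in closed form**: the order-`0` allowance sum is `≤ (16/15)·Gfr 0·|U|`. -/
theorem allowanceSum_zero_le {R : RenConsts} (hR : ∀ j, 0 ≤ R.Gfr j) (U : ℝ) (N : ℕ) :
    ∑ m ∈ range (N + 1), R.Gfr 0 * uPow 0 U * (4 : ℝ) ^ (((0 : ℤ) - 2) * m) ≤ 16 / 15 * (R.Gfr 0 * |U|) := by
  simp_rw [four_zpow_order_zero, uPow_zero]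
  rw [← mul_sum]
  have h0 : 0 ≤ R.Gfr 0 * |U| := mul_nonneg (hR 0) (abs_nonneg U)
  nlinarith [sum_inv_sixteen_pow_le N, h0]

/-- **(h1) in closed form**: the order-`1` allowance sum is `≤ (4/3)·Gfr 1·U²`. -/
theorem allowanceSum_one_le {R : RenConsts} (hR : ∀ j, 0 ≤ R.Gfr j) (U : ℝ) (N : ℕ) :
    ∑ m ∈ range (N + 1), R.Gfr 1 * uPow 1 U * (4 : ℝ) ^ (((1 : ℤ) - 2) * m) ≤ 4 / 3 * (R.Gfr 1 * U ^ 2) := by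
  simp_rw [four_zpow_order_one, uPow_succ]
  rw [← mul_sum]
  have h1 : 0 ≤ R.Gfr 1 * U ^ 2 := mul_nonneg (hR 1) (sq_nonneg U)
  nlinarith [sum_inv_four_pow_le N, h1]

/-- **(h2) in closed form**: the orders-`≤ 2` double sum is `≤ (16/15)·Gfr 0·|U| + (4/3)·Gfr 1·U² + Gfr 2·U²·(N+1)` — the order-`2`
column does not decay along the slots. -/
theorem allowanceSum_two_le {R : RenConsts} (hR : ∀ j, 0 ≤ R.Gfr j) (U : ℝ) (N : ℕ) :
    ∑ m ∈ range (N + 1), ∑ j ∈ range 3, R.Gfr j * uPow j U * (4 : ℝ) ^ (((j : ℤ) - 2) * m) ≤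
      16 / 15 * (R.Gfr 0 * |U|) + 4 / 3 * (R.Gfr 1 * U ^ 2) + R.Gfr 2 * U ^ 2 * ((N : ℝ) + 1) := by
  have hsplit : ∀ m : ℕ, ∑ j ∈ range 3, R.Gfr j * uPow j U * (4 : ℝ) ^ (((j : ℤ) - 2) * m) =
      R.Gfr 0 * uPow 0 U * (4 : ℝ) ^ (((0 : ℤ) - 2) * m) + R.Gfr 1 * uPow 1 U * (4 : ℝ) ^ (((1 : ℤ) - 2) * m) +
        R.Gfr 2 * U ^ 2 := by
    intro m
    simp only [sum_range_succ, sum_range_zero, zero_add, Nat.cast_zero, Nat.cast_one, Nat.cast_ofNat]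
    rw [four_zpow_order_two, show uPow 2 U = U ^ 2 from uPow_succ 1 U]
    ring
  simp_rw [hsplit]
  rw [sum_add_distrib, sum_add_distrib, sum_const, card_range, nsmul_eq_mul]
  push_cast
  have hA := allowanceSum_zero_le hR U N
  have hB := allowanceSum_one_le hR U N
  nlinarith [hA, hB]

/-! ## §2 The regime thresholds for the three allowance sums (any package `R`) -/

/-- **Thresholds for the `GeomConstants` half of `FrameOK`** (the shape of `frameOK_of_pieces` / `frameOK_of_multiSlot`): for every package `R`
with `Gfr ≥ 0` there are explicit `c₂, U₂ > 0` such that for `0 ≤ c ≤ c₂`, `0 < U ≤ U₂` and every `β` of the regime `klBetaMin ≤ β ≤ e^{c/U²}`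
the three order-`≤ 2` allowance sums over the slots `m ≤ nScales β` are `≤ 3/80`, `≤ 1/2000`, `≤ 1/100`. -/
theorem allowanceSums_thresholds {R : RenConsts} (hR : ∀ j, 0 ≤ R.Gfr j) :
    ∃ c₂ : ℝ, 0 < c₂ ∧ ∃ U₂ : ℝ, 0 < U₂ ∧ ∀ c U β : ℝ, 0 ≤ c → c ≤ c₂ → 0 < U → U ≤ U₂ →
      klBetaMin ≤ β → β ≤ Real.exp (c / U ^ 2) →
        (∑ m ∈ range (nScales β + 1), R.Gfr 0 * uPow 0 U * (4 : ℝ) ^ (((0 : ℤ) - 2) * m) ≤ 3 / 80) ∧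
        (∑ m ∈ range (nScales β + 1), R.Gfr 1 * uPow 1 U * (4 : ℝ) ^ (((1 : ℤ) - 2) * m) ≤ 1 / 2000) ∧
        (∑ m ∈ range (nScales β + 1), ∑ j ∈ range 3, R.Gfr j * uPow j U * (4 : ℝ) ^ (((j : ℤ) - 2) * m) ≤ 1 / 100) := by
  have h0 := hR 0; have h1 := hR 1; have h2 := hR 2
  -- `1 ≤ log 4` (as in `PerturbedFermiCurve.frame_thresholds`; the tree's `…GreenTao2008.one_le_log_four` is not worth the import)
  have one_le_log_four : (1 : ℝ) ≤ Real.log 4 := by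
    have h4 : Real.exp 1 ≤ 4 := by
      have := Real.exp_one_lt_d9; norm_num at this; linarith
    calc (1 : ℝ) = Real.log (Real.exp 1) := (Real.log_exp 1).symm
      _ ≤ Real.log 4 := Real.log_le_log (Real.exp_pos 1) h4
  refine ⟨1 / (400 * (R.Gfr 2 + 1)), by positivity, min 1 (1 / (6000 * (R.Gfr 0 + R.Gfr 1 + 1))),
    lt_min one_pos (by positivity), ?_⟩
  intro c U β hc hcle hU hUle hβmin hβc
  have hU1 : U ≤ 1 := hUle.trans (min_le_left _ _)
  have hUk : U ≤ 1 / (6000 * (R.Gfr 0 + R.Gfr 1 + 1)) := hUle.trans (min_le_right _ _)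
  have hUabs : |U| = U := abs_of_pos hU
  have hU2 : U ^ 2 ≤ U := by nlinarith
  -- `(Gfr 0 + Gfr 1 + 1)·U ≤ 1/6000`
  have hlin : (R.Gfr 0 + R.Gfr 1 + 1) * U ≤ 1 / 6000 := by
    have hpos : 0 < 6000 * (R.Gfr 0 + R.Gfr 1 + 1) := by positivity
    have := (le_div_iff₀ hpos).mp hUk
    linarith
  -- the order-2 column through the regime: `Gfr 2·U²·(N+1) ≤ Gfr 2·c/log 4 ≤ Gfr 2·c ≤ 1/400`
  have hreg := sq_mul_nScales_succ_le hc hβmin hβc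
  have hcol : R.Gfr 2 * U ^ 2 * ((nScales β : ℝ) + 1) ≤ 1 / 400 := by
    have hc4 : c / Real.log 4 ≤ c := div_le_self hc one_le_log_four
    have hpos : 0 < 400 * (R.Gfr 2 + 1) := by positivity
    have hcc := (le_div_iff₀ hpos).mp hcle
    calc R.Gfr 2 * U ^ 2 * ((nScales β : ℝ) + 1) = R.Gfr 2 * (U ^ 2 * ((nScales β : ℝ) + 1)) := by ring
      _ ≤ R.Gfr 2 * c := mul_le_mul_of_nonneg_left (hreg.trans hc4) h2
      _ ≤ 1 / 400 := by nlinarith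
  have hA := allowanceSum_zero_le hR U (nScales β)
  have hB := allowanceSum_one_le hR U (nScales β)
  have hC := allowanceSum_two_le hR U (nScales β)
  rw [hUabs] at hA hC
  have hA' : 16 / 15 * (R.Gfr 0 * U) ≤ 2 * (R.Gfr 0 * U) := by nlinarith [mul_nonneg h0 hU.le]
  have hB' : 4 / 3 * (R.Gfr 1 * U ^ 2) ≤ 2 * (R.Gfr 1 * U) := by
    nlinarith [mul_le_mul_of_nonneg_left hU2 h1, mul_nonneg h1 (sq_nonneg U)]
  refine ⟨?_, ?_, ?_⟩
  · nlinarith [mul_nonneg h1 hU.le]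
  · nlinarith [mul_nonneg h0 hU.le]
  · nlinarith

/-! ## §3 Child 2's package `ctRenMs G`: all five side conditions of `frameOK_of_multiSlot` -/

/-- **(ha)**: once `Q.S′ j·|U| ≤ 1` for `j ≤ 4`, the doubled allowance of `ctRenMs G` absorbs the two-leg sizes:
`2(G.S j + Q.S′ j|U|) ≤ (ctRenMs G).Gfr j`. -/
theorem ctRenMs_room (G : GeoConsts) {Q : EngConsts} (hQ : Q.WF) {U : ℝ} (hU0 : 0 ≤ U)
    (hU : U * (Q.S' 0 + Q.S' 1 + Q.S' 2 + Q.S' 3 + Q.S' 4 + 1) ≤ 1) :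
    ∀ j ≤ 4, 2 * (G.S j + Q.S' j * |U|) ≤ (ctRenMs G).Gfr j := by
  have hS' : ∀ j, 0 ≤ Q.S' j := hQ.2.2.2.2.1
  intro j hj
  refine two_mul_add_le_ctRenMs_Gfr G j ?_
  rw [abs_of_nonneg hU0]
  have hle : Q.S' j ≤ Q.S' 0 + Q.S' 1 + Q.S' 2 + Q.S' 3 + Q.S' 4 + 1 := by
    have := hS' 0; have := hS' 1; have := hS' 2; have := hS' 3; have := hS' 4
    interval_cases j <;> linarith
  calc Q.S' j * U ≤ (Q.S' 0 + Q.S' 1 + Q.S' 2 + Q.S' 3 + Q.S' 4 + 1) * U :=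
        mul_le_mul_of_nonneg_right hle hU0
    _ ≤ 1 := by linarith

/-- **(hb)**: `Σ_{i ≤ n} msBar G Q U i ≤ 1/2` once `0 ≤ U ≤ 1` and `U·(256/3)·klMsKappa… `, precisely
`klMsKappa·(G.S 1 + Q.S′ 1)·U·(4/3) ≤ 1/2` (with `U ≤ 1`: `S′ 1·|U| ≤ S′ 1` and `U² ≤ U`). -/
theorem sum_msBar_le_half {G : GeoConsts} {Q : EngConsts} (hG : G.WF) (hQ : Q.WF) {U : ℝ} (hU0 : 0 ≤ U) (hU1 : U ≤ 1)
    (hU : klMsKappa * (G.S 1 + Q.S' 1) * U * (4 / 3) ≤ 1 / 2) (n : ℕ) :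
    ∑ i ∈ range (n + 1), msBar G Q U i ≤ 1 / 2 := by
  have hS : 0 ≤ G.S 1 := hG.2.2.2.2.2.2.2.2.2.2.2.2.2.2.2.2.2.1 1
  have hS' : 0 ≤ Q.S' 1 := hQ.2.2.2.2.1 1
  have hκ := klMsKappa_pos
  refine (sum_msBar_le hG hQ U (n + 1)).trans ?_
  rw [abs_of_nonneg hU0]
  have hU2 : U ^ 2 ≤ U := by nlinarith
  have h1 : G.S 1 + Q.S' 1 * U ≤ G.S 1 + Q.S' 1 := by nlinarith
  have h2 : klMsKappa * (G.S 1 + Q.S' 1 * U) * U ^ 2 * (4 / 3) ≤ klMsKappa * (G.S 1 + Q.S' 1) * U * (4 / 3) := by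
    have ha : 0 ≤ klMsKappa * (G.S 1 + Q.S' 1 * U) := by positivity
    have hb : 0 ≤ klMsKappa * (G.S 1 + Q.S' 1) := by positivity
    calc klMsKappa * (G.S 1 + Q.S' 1 * U) * U ^ 2 * (4 / 3)
          ≤ klMsKappa * (G.S 1 + Q.S' 1 * U) * U * (4 / 3) := by nlinarith [mul_nonneg ha (sub_nonneg.2 hU2)]
      _ ≤ klMsKappa * (G.S 1 + Q.S' 1) * U * (4 / 3) := by nlinarith [mul_nonneg (mul_nonneg hκ.le (sub_nonneg.2 h1)) hU0]
  exact h2.trans hU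

/-- **THE THRESHOLDS OF CHILD 2's SELF-MAP (all five side conditions of `frameOK_of_multiSlot` at `R = ctRenMs G`).**  For well-formed
`G, Q` there are explicit `c₂, U₂ > 0` (functions of `G, Q`) such that for every `0 ≤ c ≤ c₂`, `0 < U ≤ U₂` and every `β` with
`klBetaMin ≤ β ≤ e^{c/U²}`: (ha) `∀ j ≤ 4, 2(G.S j + Q.S′ j|U|) ≤ (ctRenMs G).Gfr j`; (hb) `∀ n, Σ_{i ≤ n} msBar G Q U i ≤ 1/2`; (h0)–(h2) the
three allowance sums of `ctRenMs G` over the slots `m ≤ nScales β` are `≤ 3/80, 1/2000, 1/100`.  With these, `frameOK_of_multiSlot` gives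
`FrameOK (ctRenMs G) U (nScales β) μ (P^G(K) ⊖ D_n^G(K))` from (E3a-MS) at the scales `≤ n` alone — at every Picard iterate of the wholesale
continuation, with no arithmetic left inline. -/
theorem ctRenMs_thresholds {G : GeoConsts} {Q : EngConsts} (hG : G.WF) (hQ : Q.WF) :
    ∃ c₂ : ℝ, 0 < c₂ ∧ ∃ U₂ : ℝ, 0 < U₂ ∧ ∀ c U β : ℝ, 0 ≤ c → c ≤ c₂ → 0 < U → U ≤ U₂ →
      klBetaMin ≤ β → β ≤ Real.exp (c / U ^ 2) →
        (∀ j ≤ 4, 2 * (G.S j + Q.S' j * |U|) ≤ (ctRenMs G).Gfr j) ∧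
        (∀ n : ℕ, ∑ i ∈ range (n + 1), msBar G Q U i ≤ 1 / 2) ∧
        (∑ m ∈ range (nScales β + 1), (ctRenMs G).Gfr 0 * uPow 0 U * (4 : ℝ) ^ (((0 : ℤ) - 2) * m) ≤ 3 / 80) ∧
        (∑ m ∈ range (nScales β + 1), (ctRenMs G).Gfr 1 * uPow 1 U * (4 : ℝ) ^ (((1 : ℤ) - 2) * m) ≤ 1 / 2000) ∧
        (∑ m ∈ range (nScales β + 1), ∑ j ∈ range 3,
            (ctRenMs G).Gfr j * uPow j U * (4 : ℝ) ^ (((j : ℤ) - 2) * m) ≤ 1 / 100) := by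
  have hR : ∀ j, 0 ≤ (ctRenMs G).Gfr j := (ctRenMs_WF2 hG).1.2.2
  have hS : 0 ≤ G.S 1 := hG.2.2.2.2.2.2.2.2.2.2.2.2.2.2.2.2.2.1 1
  have hS' : ∀ j, 0 ≤ Q.S' j := hQ.2.2.2.2.1
  have hκ := klMsKappa_pos
  obtain ⟨c₂, hc₂, U₂, hU₂, hthr⟩ := allowanceSums_thresholds hR
  -- the two extra `U`-thresholds of (ha) and (hb)
  set A : ℝ := Q.S' 0 + Q.S' 1 + Q.S' 2 + Q.S' 3 + Q.S' 4 + 1 with hA_def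
  set B : ℝ := klMsKappa * (G.S 1 + Q.S' 1) * (4 / 3) + 1 with hB_def
  have hA : 0 < A := by
    have := hS' 0; have := hS' 1; have := hS' 2; have := hS' 3; have := hS' 4
    rw [hA_def]; linarith
  have hB : 0 < B := by rw [hB_def]; have := hS' 1; positivity
  refine ⟨c₂, hc₂, min U₂ (min 1 (min (1 / A) (1 / (2 * B)))), ?_, ?_⟩
  · exact lt_min hU₂ (lt_min one_pos (lt_min (by positivity) (by positivity)))
  intro c U β hc hcle hU hUle hβmin hβc
  have hUU₂ : U ≤ U₂ := hUle.trans (min_le_left _ _)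
  have hU1 : U ≤ 1 := (hUle.trans (min_le_right _ _)).trans (min_le_left _ _)
  have hUA : U ≤ 1 / A := ((hUle.trans (min_le_right _ _)).trans (min_le_right _ _)).trans (min_le_left _ _)
  have hUB : U ≤ 1 / (2 * B) := ((hUle.trans (min_le_right _ _)).trans (min_le_right _ _)).trans (min_le_right _ _)
  obtain ⟨h0, h1, h2⟩ := hthr c U β hc hcle hU hUU₂ hβmin hβc
  refine ⟨ctRenMs_room G hQ hU.le ?_, fun n => sum_msBar_le_half hG hQ hU.le hU1 ?_ n, h0, h1, h2⟩
  · -- `U·A ≤ 1`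
    have := (le_div_iff₀ hA).mp hUA
    linarith
  · -- `klMsKappa·(S 1 + S′ 1)·U·(4/3) ≤ 1/2` from `U ≤ 1/(2B)`
    have h2B : 0 < 2 * B := by positivity
    have hle := (le_div_iff₀ h2B).mp hUB
    have hcoef : 0 ≤ klMsKappa * (G.S 1 + Q.S' 1) * (4 / 3) := by have := hS' 1; positivity
    calc klMsKappa * (G.S 1 + Q.S' 1) * U * (4 / 3) = klMsKappa * (G.S 1 + Q.S' 1) * (4 / 3) * U := by ring
      _ ≤ B * U := by rw [hB_def]; nlinarith
      _ ≤ 1 / 2 := by nlinarith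

/-! ## §4 The construction volume -/

/-- **The construction volume `L₀`**: for finitely many nonnegative rates `a n` (`n ≤ N`) against POSITIVE tolerances `t n`, and any floor
`Lmin`, there is a natural `L₀ ≥ Lmin`, `L₀ > 0`, with `a n / L₀ ≤ t n` for every `n ≤ N` (take `L₀` above `Σ_n a n / t n`).  The
`Q.CL β n / L₀ ≤ ½·tol_n` clause of `CtOneVolumeMsV11` (`N = nScales β`, `a n = Q.CL β n`). -/
theorem exists_volume_threshold {N : ℕ} {a t : ℕ → ℝ} (ha : ∀ n ≤ N, 0 ≤ a n) (ht : ∀ n ≤ N, 0 < t n) (Lmin : ℕ) :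
    ∃ L₀ : ℕ, 0 < L₀ ∧ Lmin ≤ L₀ ∧ ∀ n ≤ N, a n / (L₀ : ℝ) ≤ t n := by
  set S : ℝ := ∑ n ∈ range (N + 1), a n / t n with hS_def
  obtain ⟨L₁, hL₁⟩ := exists_nat_ge S
  refine ⟨max (max Lmin 1) L₁, ?_, ?_, ?_⟩
  · exact lt_of_lt_of_le one_pos ((le_max_right _ _).trans (le_max_left _ _))
  · exact (le_max_left _ _).trans (le_max_left _ _)
  intro n hn
  have hL₀pos : (0 : ℝ) < (max (max Lmin 1) L₁ : ℕ) := by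
    have : 1 ≤ max (max Lmin 1) L₁ := (le_max_right _ _).trans (le_max_left _ _)
    exact_mod_cast this
  have hterm : a n / t n ≤ S := by
    rw [hS_def]
    exact single_le_sum (f := fun n => a n / t n)
      (fun i hi => div_nonneg (ha i (Nat.lt_succ_iff.mp (mem_range.mp hi))) (ht i (Nat.lt_succ_iff.mp (mem_range.mp hi))).le)
      (mem_range.mpr (Nat.lt_succ_of_le hn))
  have hSL : S ≤ (max (max Lmin 1) L₁ : ℕ) := by
    refine hL₁.trans ?_
    exact_mod_cast le_max_right _ _
  rw [div_le_iff₀ hL₀pos]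
  have htn := ht n hn
  have := (div_le_iff₀ htn).mp (hterm.trans hSL)
  linarith

end Summit.HubbardSuperconductivity.HubbardSuperconductivity.Theorems.KLRegimeSplit

end
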